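import Summits.CriticalPhenomena.CardyFormulaZ2.Theorems.CardyBoundaryCoulombGasBoundaryDefectGaussianRStubRealisabilityPart41

/-!
# Stub `stub_realisability` of line `rainbow-monomials-in-excursion-kernels` — Part 43:
# Lemma V — III: the cells around one straight boundary dart and their levels (`strip_pair`)
# (crux `BoundaryDefectGaussianR`, stmt-CriticalPhenomena-14132)

The local computation at the heart of Lemma V. Let dart `c = (z, k)` of the boundary cycle of an
admissible datum lie on a STRAIGHT stretch: the darts before and after it are `(z ∓ τ, k)`
(`τ = dir (k+1)`, `n = dir k`), the rows `z + jτ`, `z + jτ - n` behind the wall are in `V` and the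
two rows `z + jτ + n`, `z + jτ + 2n` in front are not (`j` near `0`). Then (straight geometry, first
section): the only exterior dart at `z` is `(z, k)`; a non-interior face at `z` is the gap face of
`c` or of the dart before (registered as `s13_straightFaces`); a face of `V` at the ghost `z + n`
likewise; the ghost's only neighbour in `V` is `z`. Hence (second section, reading
`LegInsertionData.collar` through Part 7): the collar face `gapFace (z, k)` carries the level AFTER
dart `c` (`strip_faceH`); the arc vertex `z` and the ghost `z + n` are prescribed iff a wired stretch
touches dart `c`, and then carry the wired level AT dart `c` (`strip_vertH_vertex`,
`strip_vertH_ghost`: all mentions — tip of the dart, outer corner of the pockets before and after —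
agree). **`strip_pair`**: if the stretch after `c` is free, every prescribed vertex-cell at the face
`gapFace (z, k)` (its corners `z`, `z + n`, `z + τ`, `z + τ + n`) reads a wired level at one end of a
JUNCTION whose other end is the face's level, so the two differ by exactly one
(`abs_level_sub_of_flip`, from the step trichotomy of Part 8).
-/

namespace Summit.CriticalPhenomena.CardyFormulaZ2.Cruxes.BoundaryDefectGaussianR.RainbowMonomialsInExcursionKernels

open Literature.Probability.LatticeModels Literature.Probability.LatticeModels.CollarLegModel

/-- The four elements of `Fin 4` (file-local copy). [folklore] -/
private theorem fin4_cases (i : Fin 4) : i = 0 ∨ i = 1 ∨ i = 2 ∨ i = 3 := by fin_cases i <;> simp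

/-- Every direction is `k + i` for some `i` (file-local copy). [folklore] -/
private theorem fin4_exists_add (k j : Fin 4) : ∃ i : Fin 4, j = k + i := ⟨j - k, by revert j k; decide⟩

section StraightGeometry

variable {V : Finset (ℤ × ℤ)} {z : ℤ × ℤ} {k : Fin 4}

/-- The gap face of the dart before `(z, k)` on a straight wall is the face `k + 3` at `z`. [folklore] -/
theorem gapFace_pred_straight (z : ℤ × ℤ) (k : Fin 4) : gapFace (z - dir (k + 1), k) = gapFace (z, k + 3) := by
  have := (gapFace_corner (z - dir (k + 1)) k).2.2
  rw [sub_add_cancel] at this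
  exact this.symm

/-- **On a straight wall the exterior dart at a vertex is unique**: if `z - dir k`, `z ± dir (k+1)`
are in `V` then the only direction pointing out of `V` at `z` is `k`. [folklore] -/
theorem dir_eq_of_straight (h1 : z + dir (k + 1) ∈ V) (h2 : z - dir k ∈ V) (h3 : z - dir (k + 1) ∈ V)
    {j : Fin 4} (hj : z + dir j ∉ V) : j = k := by
  obtain ⟨i, rfl⟩ := fin4_exists_add k j
  rcases fin4_cases i with rfl | rfl | rfl | rfl
  · simp
  · exact absurd h1 hj
  · exact absurd h2 (nmem_of_eq hj (by rw [tp_dir_add_two]; abel))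
  · exact absurd h3 (nmem_of_eq hj (by rw [tp_dir_add_three]; abel))

/-- **A ghost's only neighbour in `V` on a straight wall is the vertex below it.** [folklore] -/
theorem dir_eq_of_ghost (hNN : z + dir k + dir k ∉ V) (hNE : z + dir (k + 1) + dir k ∉ V)
    (hNW : z - dir (k + 1) + dir k ∉ V) {j : Fin 4} (hj : z + dir k + dir j ∈ V) : j = k + 2 := by
  obtain ⟨i, rfl⟩ := fin4_exists_add k j
  rcases fin4_cases i with rfl | rfl | rfl | rfl
  · exact absurd (mem_of_eq hj (by rw [add_zero])) hNN
  · exact absurd (mem_of_eq hj (by abel)) hNE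
  · rfl
  · exact absurd (mem_of_eq hj (by rw [tp_dir_add_three]; abel)) hNW

/-- **Faces at a straight-wall vertex.** A non-interior face at `z` is the gap face of the dart
`(z, k)` or of the dart `(z - dir (k+1), k)` before it. [folklore] -/
theorem face_at_straight (h0 : z ∈ V) (hE : z + dir (k + 1) ∈ V) (hS : z - dir k ∈ V) (hW : z - dir (k + 1) ∈ V)
    (hSW : z - dir (k + 1) - dir k ∈ V) (hSE : z + dir (k + 1) - dir k ∈ V)
    {f : ℤ × ℤ} (hf : f ∈ SixVertex.vertexFaces z) (hni : f ∉ interiorFaces V) :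
    f = gapFace (z, k) ∨ f = gapFace (z - dir (k + 1), k) := by
  obtain ⟨j, rfl⟩ := mem_vertexFaces_iff_gapFace.mp hf
  obtain ⟨i, rfl⟩ := fin4_exists_add k j
  rcases fin4_cases i with rfl | rfl | rfl | rfl
  · left; simp
  · refine absurd (gapFace_mem_interiorFaces h0 hE ?_ ?_) hni
    · exact mem_of_eq hS (by rw [fin4_add_one_add_one, tp_dir_add_two]; abel)
    · exact mem_of_eq hSE (by rw [fin4_add_one_add_one, tp_dir_add_two]; abel)
  · refine absurd (gapFace_mem_interiorFaces h0 ?_ ?_ ?_) hni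
    · exact mem_of_eq hS (by rw [tp_dir_add_two]; abel)
    · exact mem_of_eq hW (by rw [fin4_add_two_add_one, tp_dir_add_three]; abel)
    · exact mem_of_eq hSW (by rw [fin4_add_two_add_one, tp_dir_add_two, tp_dir_add_three]; abel)
  · right; rw [gapFace_pred_straight]

/-- **Faces at the ghost outside a straight-wall vertex.** A face of `V` at `z + dir k` is the gap
face of `(z, k)` or of the dart before it. [folklore] -/
theorem face_at_ghost (hN : z + dir k ∉ V) (hNN : z + dir k + dir k ∉ V) (hNE : z + dir (k + 1) + dir k ∉ V)
    (hNW : z - dir (k + 1) + dir k ∉ V) (hNNE : z + dir (k + 1) + dir k + dir k ∉ V)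
    (hNNW : z - dir (k + 1) + dir k + dir k ∉ V)
    {f : ℤ × ℤ} (hf : f ∈ SixVertex.vertexFaces (z + dir k)) (hfV : f ∈ SixVertex.faces V) :
    f = gapFace (z, k) ∨ f = gapFace (z - dir (k + 1), k) := by
  obtain ⟨j, rfl⟩ := mem_vertexFaces_iff_gapFace.mp hf
  obtain ⟨i, rfl⟩ := fin4_exists_add k j
  rcases fin4_cases i with rfl | rfl | rfl | rfl
  · refine absurd hfV (not_mem_faces_of_corners fun v hv => ?_)
    rcases (mem_faceCorners_gapFace _ _ _).mp hv with rfl | rfl | rfl | rfl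
    · exact hN
    · exact nmem_of_eq hNN (by rw [add_zero])
    · exact nmem_of_eq hNE (by rw [add_zero]; abel)
    · exact nmem_of_eq hNNE (by rw [add_zero]; abel)
  · left; exact (gapFace_corner z k).1
  · right
    have := (gapFace_corner z (k + 3)).2.2
    rw [fin4_add_three_add_one, fin4_add_three_add_three] at this
    rw [this, gapFace_pred_straight]
  · refine absurd hfV (not_mem_faces_of_corners fun v hv => ?_)
    rcases (mem_faceCorners_gapFace _ _ _).mp hv with rfl | rfl | rfl | rfl
    · exact hN
    · exact nmem_of_eq hNW (by rw [tp_dir_add_three]; abel)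
    · exact nmem_of_eq hNN (by rw [fin4_add_three_add_one])
    · exact nmem_of_eq hNNW (by rw [fin4_add_three_add_one, tp_dir_add_three]; abel)

/-- **The corners of the gap face of `(z, k)`.** [folklore] -/
theorem corner_cases {x : ℤ × ℤ} (hx : gapFace (z, k) ∈ SixVertex.vertexFaces x) :
    x = z ∨ x = z + dir k ∨ x = z + dir (k + 1) ∨ x = z + dir (k + 1) + dir k := by
  rcases (mem_faceCorners_gapFace _ _ _).mp (se_mem_faceCorners_of_mem_vertexFaces hx) with h | h | h | h
  · exact Or.inl h
  · exact Or.inr (Or.inl h)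
  · exact Or.inr (Or.inr (Or.inl h))
  · exact Or.inr (Or.inr (Or.inr (h.trans (add_right_comm _ _ _))))

end StraightGeometry


/-! ### The walk read on a straight stretch: levels of the cells around one straight dart -/

section StraightWalk

variable (ι : LegInsertionData) (V : Finset (ℤ × ℤ)) {d₀ : Dart} (hadm : ι.IsAdmissible V)
  (h0 : outDart V ι.sink = some d₀) {st : ℕ → WalkState}
  (hst : ∀ t, st t = List.foldl (fun s d => s.step (ι.startAt V d)) ι.init ((cycle V d₀).take t))
  {c cp : ℕ} {z : ℤ × ℤ} {k : Fin 4}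
  (hc : c < (cycle V d₀).length) (hzc : (cycle V d₀)[c] = (z, k))
  (hcp : cp < (cycle V d₀).length) (hcp1 : (cp + 1) % (cycle V d₀).length = c)
  (hzp : (cycle V d₀)[cp] = (z - dir (k + 1), k))
  (m0 : z ∈ V) (mW : z - dir (k + 1) ∈ V) (mE : z + dir (k + 1) ∈ V) (mS : z - dir k ∈ V)
  (nN : z + dir k ∉ V) (nNW : z - dir (k + 1) + dir k ∉ V) (nNE : z + dir (k + 1) + dir k ∉ V)
  (nNN : z + dir k + dir k ∉ V) (nNNW : z - dir (k + 1) + dir k + dir k ∉ V)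
  (nNNE : z + dir (k + 1) + dir k + dir k ∉ V)

include hadm h0 hc hzc mE mS mW in
/-- On a straight stretch, the only cycle dart at `z` is dart `c`. [folklore] -/
theorem strip_index_of_vertex {t : ℕ} (ht : t < (cycle V d₀).length) (hv : ((cycle V d₀)[t]).1 = z) : t = c := by
  obtain ⟨hv₀, ht₀⟩ := sinkDart_exterior ι V hadm h0
  have hex := cycle_getElem_exterior ι V hadm h0 ht
  rw [hv] at hex
  have hj := dir_eq_of_straight mE mS mW hex.2
  apply cycle_inj hv₀ ht₀ (hs := ht) (ht := hc)
  rw [hzc, Prod.ext_iff]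
  exact ⟨hv, hj⟩

include hadm h0 hc hzc mE in
/-- On a straight stretch, the only cycle dart whose gap face is the gap face of dart `c` is dart `c`. [folklore] -/
theorem strip_index_of_gapFace {t : ℕ} (ht : t < (cycle V d₀).length)
    (hg : gapFace (cycle V d₀)[t] = gapFace (z, k)) : t = c := by
  obtain ⟨hv₀, ht₀⟩ := sinkDart_exterior ι V hadm h0
  have hex := cycle_getElem_exterior ι V hadm h0 ht
  have hzV : z ∈ V := by have := (cycle_getElem_exterior ι V hadm h0 hc).1; rwa [hzc] at this
  have hzk : z + dir k ∉ V := by have := (cycle_getElem_exterior ι V hadm h0 hc).2; rwa [hzc] at this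
  have := exterior_dart_unique hzV hzk (fun h => absurd mE h) hex.1 hex.2 hg
  apply cycle_inj hv₀ ht₀ (hs := ht) (ht := hc)
  rw [hzc, ← this]

include hadm h0 hcp hzp m0 mW nNW in
/-- On a straight stretch, the only cycle dart whose gap face is the gap face of the dart before `c`
is that dart. [folklore] -/
theorem strip_index_of_gapFace_pred {t : ℕ} (ht : t < (cycle V d₀).length)
    (hg : gapFace (cycle V d₀)[t] = gapFace (z - dir (k + 1), k)) : t = cp := by
  obtain ⟨hv₀, ht₀⟩ := sinkDart_exterior ι V hadm h0
  have hex := cycle_getElem_exterior ι V hadm h0 ht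
  have := exterior_dart_unique mW nNW (fun h => absurd (mem_of_eq m0 (by abel)) h) hex.1 hex.2 hg
  apply cycle_inj hv₀ ht₀ (hs := ht) (ht := hcp)
  rw [hzp, ← this]

include hadm h0 hst hc hzc mE in
/-- **The collar face after a straight dart** carries the level after the dart (when that stretch is
free). [folklore] -/
theorem strip_faceH (hfree : (st (c + 1)).wired = false) :
    (ι.collar V).faceH (gapFace (z, k)) = (st (c + 1)).level := by
  have h := collar_faceH_gapFace ι V h0 hst hc hfree fun t' ht' _ hg =>
    absurd (strip_index_of_gapFace ι V hadm h0 hc hzc mE (t := t') (by omega) (by rw [hg, hzc])) (by omega)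
  rwa [hzc] at h

include hadm h0 hst hc hzc mE mS mW in
/-- **An arc vertex on a straight stretch** touches a wired stretch at its own dart. [folklore] -/
theorem strip_arc_vertex (hz : z ∈ (ι.collar V).arc) : (st c).wired = true ∨ (st (c + 1)).wired = true := by
  obtain ⟨t, ht, hw, hv⟩ := (mem_collar_arc_iff ι V h0 hst).1 hz
  obtain rfl := strip_index_of_vertex ι V hadm h0 hc hzc mW mE mS ht hv
  exact hw

include hadm h0 hst hc hzc m0 mE mS mW in
/-- **The level of an arc vertex on a straight stretch**: the wired level at its dart. [folklore] -/
theorem strip_vertH_vertex (hw : (st c).wired = true ∨ (st (c + 1)).wired = true) :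
    (ι.collar V).vertH z = if (st c).wired = true then (st c).level else (st (c + 1)).level := by
  obtain ⟨hv₀, ht₀⟩ := sinkDart_exterior ι V hadm h0
  refine collar_vertH_eq ι V h0 hst hc (mention_of_vertex V hw (Or.inl (by rw [hzc]))) fun t' ht' ℓ' hm => ?_
  exfalso
  have hne : LegInsertionData.mention V z ((cycle V d₀)[t'], st t', st (t' + 1)) ≠ none := by rw [hm]; simp
  rw [Ne, mention_eq_none_iff] at hne
  apply hne
  constructor
  · rintro ⟨-, hv | hv⟩
    · exact absurd (strip_index_of_vertex ι V hadm h0 hc hzc mW mE mS (by omega) hv) (by omega)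
    · have := (cycle_getElem_exterior ι V hadm h0 (t := t') (by omega)).2
      rw [← dartTip_mk, Prod.mk.eta, hv] at this
      exact this m0
  · rintro ⟨-, -, hzV⟩; exact hzV m0

include hadm h0 hst hc hzc hcp hcp1 hzp m0 mW mE mS nN nNW nNE nNN nNNW nNNE in
/-- **A ghost outside a straight stretch** touches a wired stretch at the dart below it. [folklore] -/
theorem strip_ghost (hg : z + dir k ∈ (ι.model V).ghosts) : (st c).wired = true ∨ (st (c + 1)).wired = true := by
  obtain ⟨hv₀, ht₀⟩ := sinkDart_exterior ι V hadm h0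
  have hg' := (Finset.mem_sdiff.mp hg).1
  rcases Finset.mem_union.mp hg' with h1 | h2
  · obtain ⟨y, hy, hgy⟩ := Finset.mem_biUnion.mp h1
    obtain ⟨j, hj⟩ := mem_neighbours_iff.mp hgy
    have hyz : y = z + dir k + dir (j + 2) := by rw [tp_dir_add_two, hj]; abel
    have hyV : y ∈ V := (Finset.mem_inter.mp hy).2
    rw [hyz] at hyV
    have := dir_eq_of_ghost nNN nNE nNW hyV
    have hj2 : j = k := add_right_cancel this
    rw [hj2, tp_dir_add_two, add_neg_cancel_right] at hyz
    subst hyz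
    exact strip_arc_vertex ι V hadm h0 hst hc hzc mW mE mS (Finset.mem_inter.mp hy).1
  · obtain ⟨p, hp, hgp⟩ := Finset.mem_biUnion.mp h2
    obtain ⟨hpk, hpb⟩ := Finset.mem_inter.mp hp
    have hpf : p ∈ SixVertex.faces V := (Finset.mem_filter.mp hpb).1
    obtain ⟨s0, hs0, hw0, hg0⟩ := (mem_collar_pocket_iff ι V h0 hst).1 hpk
    rcases face_at_ghost nN nNN nNE nNW nNNE nNNW (mem_vertexFaces_of_mem_faceCorners hgp) hpf with rfl | rfl
    · obtain rfl := strip_index_of_gapFace ι V hadm h0 hc hzc mE hs0 hg0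
      exact Or.inr hw0
    · obtain rfl := strip_index_of_gapFace_pred ι V hadm h0 hcp hzp m0 mW nNW hs0 hg0
      left
      rw [← (st_mod_succ ι V hadm h0 hst hs0).2, hcp1] at hw0
      exact hw0

include hadm h0 hst hc hzc hcp hcp1 hzp m0 mW mE mS nN nNW nNE nNN nNNW nNNE in
/-- **The level of a ghost outside a straight stretch** is the wired level at the dart below it
(all its mentions — tip of that dart, corner of the pockets before and after it — agree). [folklore] -/
theorem strip_vertH_ghost (hw : (st c).wired = true ∨ (st (c + 1)).wired = true) :
    (ι.collar V).vertH (z + dir k) = if (st c).wired = true then (st c).level else (st (c + 1)).level := by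
  obtain ⟨hv₀, ht₀⟩ := sinkDart_exterior ι V hadm h0
  refine collar_vertH_eq ι V h0 hst hc (mention_of_vertex V hw (Or.inr (by rw [hzc]; rfl))) fun t' ht' ℓ' hm => ?_
  have ht'P : t' < (cycle V d₀).length := by omega
  have hex := cycle_getElem_exterior ι V hadm h0 ht'P
  -- clause 1 of `mention` does not apply at `t' ≠ c`
  have hA : ¬ (((cycle V d₀)[t']).1 = z + dir k ∨ dartTip (cycle V d₀)[t'] = z + dir k) := by
    rintro (hv | hv)
    · rw [hv] at hex; exact nN hex.1
    · rw [← dartTip_mk, Prod.mk.eta] at hex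
      have h1 : ((cycle V d₀)[t']).1 = z + dir k + dir (((cycle V d₀)[t']).2 + 2) := by
        rw [tp_dir_add_two, ← hv, dartTip_mk]; abel
      have h2 := hex.1
      rw [h1] at h2
      have hj := dir_eq_of_ghost nNN nNE nNW h2
      have hj2 : ((cycle V d₀)[t']).2 = k := add_right_cancel hj
      rw [hj2, tp_dir_add_two, add_neg_cancel_right] at h1
      exact absurd (strip_index_of_vertex ι V hadm h0 hc hzc mW mE mS ht'P h1) (by omega)
  have hne : LegInsertionData.mention V (z + dir k) ((cycle V d₀)[t'], st t', st (t' + 1)) ≠ none := by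
    rw [hm]; simp
  rw [Ne, mention_eq_none_iff, not_and_or, not_not, not_not] at hne
  rcases hne with ⟨-, hv⟩ | ⟨hw', hcorner, -⟩
  · exact absurd hv hA
  -- clause 2: `z + dir k` is an outside corner of the pocket after dart `t'`
  have hm2 := mention_of_pocketCorner V (not_or.mp hA) hw' hcorner nN
  rw [hm2, Option.some.injEq] at hm
  have hpf : gapFace (cycle V d₀)[t'] ∈ SixVertex.faces V := by
    have := (gapFace_mem_bdryFaces hex.1 hex.2).1
    rw [Prod.mk.eta] at this
    exact (Finset.mem_filter.mp this).1
  rcases face_at_ghost nN nNN nNE nNW nNNE nNNW (mem_vertexFaces_of_mem_faceCorners hcorner) hpf with h | h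
  · exact absurd (strip_index_of_gapFace ι V hadm h0 hc hzc mE ht'P h) (by omega)
  · obtain rfl := strip_index_of_gapFace_pred ι V hadm h0 hcp hzp m0 mW nNW ht'P h
    have hmod := st_mod_succ ι V hadm h0 hst ht'P
    rw [hcp1] at hmod
    rw [← hm, ← hmod.1]
    rw [← hmod.2] at hw'
    simp [hw']


include hst hc in
/-- A dart across which the wiredness flips is a junction: the level moves by exactly one. [folklore] -/
theorem abs_level_sub_of_flip (hne : (st c).wired ≠ (st (c + 1)).wired) :
    |(st c).level - (st (c + 1)).level| = 1 := by
  rcases st_step_cases ι V hst hc with ⟨-, hw⟩ | ⟨hsgn, ⟨hl, -⟩ | ⟨-, hw1, hw2⟩⟩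
  · exact absurd hw.symm hne
  · rcases hsgn with h | h <;> rw [hl, h] <;> simp
  · rw [hw1, hw2] at hne; exact absurd rfl hne

include hadm h0 hst hc hzc hcp hcp1 hzp m0 mW mE mS nN nNW nNE nNN nNNW nNNE in
/-- **The prescribed corners around one straight dart.** If the stretch after the straight dart
`c = (z, k)` is free (its gap face is a collar face), then every PRESCRIBED vertex-cell at that
face — the arc vertex `z` or `z + dir (k+1)`, or the ghost above either — sits at a wired level
read at a junction adjacent to the face's level: the two differ by exactly one. [folklore] -/
theorem strip_pair (hfree : (st (c + 1)).wired = false)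
    (hcs : (cycle V d₀)[(c + 1) % (cycle V d₀).length]'(Nat.mod_lt _ (by omega)) = (z + dir (k + 1), k))
    (mEE : z + dir (k + 1) + dir (k + 1) ∈ V) (mSE : z + dir (k + 1) - dir k ∈ V)
    (nNEE : z + dir (k + 1) + dir (k + 1) + dir k ∉ V) (nNNEE : z + dir (k + 1) + dir (k + 1) + dir k + dir k ∉ V)
    {x : ℤ × ℤ} (hx : x ∈ (ι.model V).vertexCells) (hxf : (x, false) ∉ (ι.model V).freeCells)
    (hfx : gapFace (z, k) ∈ SixVertex.vertexFaces x) :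
    |(ι.collar V).vertH x - (ι.collar V).faceH (gapFace (z, k))| = 1 := by
  rw [strip_faceH ι V hadm h0 hst hc hzc mE hfree]
  have hP : 0 < (cycle V d₀).length := by omega
  have hc' : (c + 1) % (cycle V d₀).length < (cycle V d₀).length := Nat.mod_lt _ hP
  have hmod := st_mod_succ ι V hadm h0 hst hc
  have hpres := mem_arc_or_ghosts_of_not_mem_freeCells (ι.model V) hx hxf
  rcases corner_cases hfx with rfl | rfl | rfl | rfl
  · -- the arc vertex `z`
    rcases hpres with ⟨-, harc⟩ | ⟨hnV, -⟩
    · have hw := strip_arc_vertex ι V hadm h0 hst hc hzc mW mE mS harc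
      rw [hfree] at hw
      have hB : (st c).wired = true := by simpa using hw
      rw [strip_vertH_vertex ι V hadm h0 hst hc hzc m0 mW mE mS (Or.inl hB), if_pos hB]
      exact abs_level_sub_of_flip ι V hst hc (by rw [hB, hfree]; decide)
    · exact absurd m0 hnV
  · -- the ghost `z + dir k`
    rcases hpres with ⟨hV, -⟩ | ⟨-, hg⟩
    · exact absurd hV nN
    · have hw := strip_ghost ι V hadm h0 hst hc hzc hcp hcp1 hzp m0 mW mE mS nN nNW nNE nNN nNNW nNNE hg
      rw [hfree] at hw
      have hB : (st c).wired = true := by simpa using hw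
      rw [strip_vertH_ghost ι V hadm h0 hst hc hzc hcp hcp1 hzp m0 mW mE mS nN nNW nNE nNN nNNW nNNE (Or.inl hB),
        if_pos hB]
      exact abs_level_sub_of_flip ι V hst hc (by rw [hB, hfree]; decide)
  · -- the arc vertex `z + dir (k + 1)`: read at the next dart
    have hzp' : (cycle V d₀)[c] = (z + dir (k + 1) - dir (k + 1), k) := by rw [add_sub_cancel_right]; exact hzc
    have hB' : (st ((c + 1) % (cycle V d₀).length)).wired = false := by rw [hmod.2, hfree]
    rcases hpres with ⟨-, harc⟩ | ⟨hnV, -⟩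
    · have hw := strip_arc_vertex ι V hadm h0 hst hc' hcs (mem_of_eq m0 (by abel)) mEE mSE harc
      rw [hB'] at hw
      have hA : (st ((c + 1) % (cycle V d₀).length + 1)).wired = true := by simpa using hw
      rw [strip_vertH_vertex ι V hadm h0 hst hc' hcs mE (mem_of_eq m0 (by abel)) mEE mSE (Or.inr hA), if_neg (by simp [hB']),
        ← hmod.1, abs_sub_comm]
      exact abs_level_sub_of_flip ι V hst hc' (by rw [hA, hB']; decide)
    · exact absurd mE hnV
  · -- the ghost `z + dir (k + 1) + dir k`: read at the next dart
    have hzp' : (cycle V d₀)[c] = (z + dir (k + 1) - dir (k + 1), k) := by rw [add_sub_cancel_right]; exact hzc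
    have hB' : (st ((c + 1) % (cycle V d₀).length)).wired = false := by rw [hmod.2, hfree]
    rcases hpres with ⟨hV, -⟩ | ⟨-, hg⟩
    · exact absurd hV nNE
    · have hw := strip_ghost ι V hadm h0 hst hc' hcs hc rfl hzp' mE (mem_of_eq m0 (by abel)) mEE mSE nNE
        (nmem_of_eq nN (by abel)) nNEE nNNE (nmem_of_eq nNN (by abel)) nNNEE hg
      rw [hB'] at hw
      have hA : (st ((c + 1) % (cycle V d₀).length + 1)).wired = true := by simpa using hw
      rw [strip_vertH_ghost ι V hadm h0 hst hc' hcs hc rfl hzp' mE (mem_of_eq m0 (by abel)) mEE mSE nNE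
        (nmem_of_eq nN (by abel)) nNEE nNNE (nmem_of_eq nNN (by abel)) nNNEE (Or.inr hA), if_neg (by simp [hB']),
        ← hmod.1, abs_sub_comm]
      exact abs_level_sub_of_flip ι V hst hc' (by rw [hA, hB']; decide)

end StraightWalk

/-! ### Registered one-line form -/

/-- **Sub-goal `s13_straightFaces`** (registered on stmt-CriticalPhenomena-14132): on a straight
stretch of the wall (`z - dir k`, `z ± dir (k+1)`, `z ± dir (k+1) - dir k ∈ V`) a non-interior face
at `z` is the gap face of the dart `(z, k)` or of the dart `(z - dir (k+1), k)` before it. [folklore] -/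
theorem s13_straightFaces : ∀ (V : Finset (ℤ × ℤ)) (z f : ℤ × ℤ) (k : Fin 4), z ∈ V → z + Literature.Probability.LatticeModels.CollarLegModel.dir (k + 1) ∈ V → z - Literature.Probability.LatticeModels.CollarLegModel.dir k ∈ V → z - Literature.Probability.LatticeModels.CollarLegModel.dir (k + 1) ∈ V → z - Literature.Probability.LatticeModels.CollarLegModel.dir (k + 1) - Literature.Probability.LatticeModels.CollarLegModel.dir k ∈ V → z + Literature.Probability.LatticeModels.CollarLegModel.dir (k + 1) - Literature.Probability.LatticeModels.CollarLegModel.dir k ∈ V → f ∈ Literature.Probability.LatticeModels.SixVertex.vertexFaces z → f ∉ Literature.Probability.LatticeModels.CollarLegModel.interiorFaces V → f = Literature.Probability.LatticeModels.CollarLegModel.gapFace (z, k) ∨ f = Literature.Probability.LatticeModels.CollarLegModel.gapFace (z - Literature.Probability.LatticeModels.CollarLegModel.dir (k + 1), k) :=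
  fun _ _ _ _ h0 hE hS hW hSW hSE hf hni => face_at_straight h0 hE hS hW hSW hSE hf hni

end Summit.CriticalPhenomena.CardyFormulaZ2.Cruxes.BoundaryDefectGaussianR.RainbowMonomialsInExcursionKernels
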